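import Summits.CriticalPhenomena.PercolationContinuityZ3.Theorems.PercNearOneGluingNoHeavyLowerTailSunflowerGradedTBernScheme
import Summits.CriticalPhenomena.PercolationContinuityZ3.Theorems.PercNearOneGluingNoHeavyLowerTailSunflowerTBernMoves
import HarnessLib

/-!
# `NoHeavyLowerTail` (crux stmt-CriticalPhenomena-4575), abstract sunflower cubic: GRADED T-BERN — the two exchange moves
# (u-exchange, joint scaling) in the presence of the phantom block

Support file (seat `prim-ineq-prove-1` gen 69; `--supports stmt-CriticalPhenomena-4575`).  No `sorry`, no named facts, no
definitions.  Memo: run/shared/lean/prim/prim-ineq-prove-1/FINDING-GRADED-prove1-g69.md §4.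

The moves R1 (u-exchange between two slack petals) and R2 (joint scaling of two petals) of `…SunflowerTBernMoves` keep the
phantom block `x` fixed; the tightened block budget `(∏g)·x ≤ a₀^|t|` is preserved because the moves keep `∏g` exactly
(`admissibleG_uExchange`, `admissibleG_scale`), and every coefficient of `∏(A_jX+g_j)·E` for ANY `E ≥_coef 0` (here
`E = X + x`) is still of the form `p + qτ + r/τ` along the move, hence bounded by its larger endpoint value
(`coeff_uExchange_mul_le_max`, `coeff_scale_mul_le_max` — the proofs of `…SunflowerTBernMoves` with the extra factor `E`).
-/

noncomputable section

namespace Summit.CriticalPhenomena.PercolationContinuityZ3.Theorems.SunflowerPartition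

namespace SafeCalc

namespace LinkedCurrency

open Finset Polynomial

variable {ι : Type*}

/-! ## Products are invariant under the two-petal rescaling -/

/-- `∏_t` of `f` with `f_i ↦ f_iτ`, `f_j ↦ f_j/τ` (`i ≠ j ∈ t`, `τ ≠ 0`) equals `∏_t f`. [this work] -/
theorem prod_update_scale [DecidableEq ι] {t : Finset ι} {i j : ι} (hij : i ≠ j) (hi : i ∈ t) (hj : j ∈ t) (f : ι → ℝ)
    {τ : ℝ} (hτ : τ ≠ 0) :
    ∏ l ∈ t, Function.update (Function.update f i (f i * τ)) j (f j / τ) l = ∏ l ∈ t, f l := by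
  have hjt : j ∈ t.erase i := mem_erase.2 ⟨hij.symm, hj⟩
  rw [← mul_prod_erase t _ hi, ← mul_prod_erase (t.erase i) _ hjt, ← mul_prod_erase t f hi,
    ← mul_prod_erase (t.erase i) f hjt, Function.update_of_ne hij, Function.update_self, Function.update_self]
  have hrest : ∏ l ∈ (t.erase i).erase j, Function.update (Function.update f i (f i * τ)) j (f j / τ) l =
      ∏ l ∈ (t.erase i).erase j, f l :=
    prod_congr rfl fun l hl => uExchange_apply_other τ (mem_erase.1 (mem_of_mem_erase hl)).1 (mem_erase.1 hl).1
  rw [hrest]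
  field_simp

/-! ## The u-exchange -/

/-- **The u-exchange keeps graded admissibility** (`m_i ≤ u_iτ`, `m_jτ ≤ u_j`, `τ > 0`; `0 < b ≤ β`, `0 ≤ s ≤ 1`, `a₀ ≤ x`).
[this work] -/
theorem admissibleG_uExchange [DecidableEq ι] {s b β x : ℝ} (hs0 : 0 ≤ s) (hs1 : s ≤ 1) (hb : 0 < b) (hbβ : b ≤ β)
    (hax : (1 - s) * b + s * β ≤ x) {t : Finset ι} {u vv m : ι → ℝ} (hadm : AdmissibleG s b β x t u vv m) {i j : ι}
    (hij : i ≠ j) (hi : i ∈ t) (hj : j ∈ t) {τ : ℝ} (hτ : 0 < τ) (hmi : m i ≤ u i * τ) (hmj : m j * τ ≤ u j) :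
    AdmissibleG s b β x t (Function.update (Function.update u i (u i * τ)) j (u j / τ)) vv m := by
  have h1 : AdmissibleOn s b β 1 t u vv m := hadm.toOn hs0 hs1 hb hbβ hax
  have h2 : AdmissibleOn s b β 1 t (Function.update (Function.update u i (u i * τ)) j (u j / τ)) vv m :=
    admissibleOn_uExchange hb h1 hij hi hj hτ hmi hmj
  obtain ⟨hub', hu1', hvβ', hv1', hmb', hmu', hmv', hpu', -, -⟩ := h2
  obtain ⟨-, -, -, -, -, -, -, -, hpv, hpg⟩ := hadm
  exact ⟨hub', hu1', hvβ', hv1', hmb', hmu', hmv', hpu', hpv, hpg⟩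

/-- **The u-exchange with an extra factor `E ≥_coef 0`: a coefficient at `τ = 1` is at most the larger of the coefficients at
the endpoints.** [this work] -/
theorem coeff_uExchange_mul_le_max [DecidableEq ι] {s : ℝ} (hs0 : 0 ≤ s) (hs1 : s ≤ 1) {t : Finset ι} {u c : ι → ℝ}
    (hu : ∀ l ∈ t, 0 ≤ u l) (hc : ∀ l ∈ t, 0 ≤ c l) {i j : ι} (hij : i ≠ j) (hi : i ∈ t) (hj : j ∈ t)
    {tlo thi : ℝ} (hlo : 0 < tlo) (hlo1 : tlo ≤ 1) (hhi : 1 ≤ thi) {E : ℝ[X]} (hE : CoefNonneg E) (k : ℕ) :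
    (prodPoly t (fun l => s + (1 - s) * u l) c * E).coeff k ≤
      max ((prodPoly t (fun l => s + (1 - s) * Function.update (Function.update u i (u i * tlo)) j (u j / tlo) l) c *
              E).coeff k)
        ((prodPoly t (fun l => s + (1 - s) * Function.update (Function.update u i (u i * thi)) j (u j / thi) l) c *
              E).coeff k) := by
  have hs' : 0 ≤ 1 - s := sub_nonneg.2 hs1
  have hjt : j ∈ t.erase i := mem_erase.2 ⟨hij.symm, hj⟩
  have hit : i ∉ t.erase i := notMem_erase i t
  have hjt' : j ∉ (t.erase i).erase j := notMem_erase j _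
  set R₀ := prodPoly ((t.erase i).erase j) (fun l => s + (1 - s) * u l) c with hR₀d
  set R := R₀ * E with hRd
  have hR : CoefNonneg R := (coefNonneg_prodPoly _
    (fun l hl => add_nonneg hs0 (mul_nonneg hs' (hu l (mem_of_mem_erase (mem_of_mem_erase hl)))))
    (fun l hl => hc l (mem_of_mem_erase (mem_of_mem_erase hl)))).mul hE
  have e4 : ∀ p q r e : ℝ[X], p * (q * r) * e = p * q * (r * e) := fun _ _ _ _ => by ring
  -- factorization of the three families (times `E`)
  have fac : ∀ τ : ℝ, τ ≠ 0 →
      prodPoly t (fun l => s + (1 - s) * Function.update (Function.update u i (u i * τ)) j (u j / τ) l) c * E =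
        (C ((s ^ 2 + (1 - s) ^ 2 * (u i * u j)) + s * (1 - s) * u i * τ + s * (1 - s) * u j / τ) * X ^ 2 +
          C ((s * c j + s * c i) + (1 - s) * u i * c j * τ + (1 - s) * u j * c i / τ) * X +
          C (c i * c j + 0 * τ + 0 / τ)) * R := by
    intro τ hτ
    set u' := Function.update (Function.update u i (u i * τ)) j (u j / τ) with hu'
    have hu'i : u' i = u i * τ := by rw [hu', Function.update_of_ne hij, Function.update_self]
    have hu'j : u' j = u j / τ := by rw [hu', Function.update_self]
    have hrest : prodPoly ((t.erase i).erase j) (fun l => s + (1 - s) * u' l) c = R₀ :=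
      prodPoly_congr (fun l hl => by
        rw [hu', uExchange_apply_other τ (mem_erase.1 (mem_of_mem_erase hl)).1 (mem_erase.1 hl).1]) (fun _ _ => rfl)
    rw [← insert_erase hi, prodPoly_insert hit, ← insert_erase hjt, prodPoly_insert hjt', hrest, e4,
      lin_mul_lin, hu'i, hu'j]
    have e2 : (s + (1 - s) * (u i * τ)) * (s + (1 - s) * (u j / τ)) =
        (s ^ 2 + (1 - s) ^ 2 * (u i * u j)) + s * (1 - s) * u i * τ + s * (1 - s) * u j / τ := by
      field_simp; ring
    have e1 : (s + (1 - s) * (u i * τ)) * c j + c i * (s + (1 - s) * (u j / τ)) =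
        (s * c j + s * c i) + (1 - s) * u i * c j * τ + (1 - s) * u j * c i / τ := by
      field_simp; ring
    have e0 : c i * c j = c i * c j + 0 * τ + 0 / τ := by ring
    rw [e2, e1, ← e0]
  have fac1 : prodPoly t (fun l => s + (1 - s) * u l) c * E =
      (C ((s ^ 2 + (1 - s) ^ 2 * (u i * u j)) + s * (1 - s) * u i + s * (1 - s) * u j) * X ^ 2 +
        C ((s * c j + s * c i) + (1 - s) * u i * c j + (1 - s) * u j * c i) * X + C (c i * c j + 0 + 0)) * R := by
    have h := fac 1 one_ne_zero
    simp only [mul_one, div_one] at h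
    have hu1 : Function.update (Function.update u i (u i)) j (u j) = u := by
      rw [Function.update_eq_self, Function.update_eq_self]
    rw [hu1] at h
    exact h
  rw [fac1, fac tlo hlo.ne', fac thi (by linarith)]
  exact coeff_quad_mul_le_max hR k (mul_nonneg (mul_nonneg hs0 hs') (hu j hj))
    (mul_nonneg (mul_nonneg hs' (hu j hj)) (hc i hi)) le_rfl hlo hlo1 hhi

/-! ## The joint scaling of two petals -/

/-- **The scaling move keeps graded admissibility**: petal `i` scaled by `τ`, petal `j` by `1/τ`, as long as
`b ≤ m_iτ`, `β ≤ vv_iτ`, `bτ ≤ m_j`, `βτ ≤ vv_j`, `τ > 0` (`0 < b ≤ β`, `0 ≤ s ≤ 1`, `a₀ ≤ x`). [this work] -/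
theorem admissibleG_scale [DecidableEq ι] {s b β x : ℝ} (hs0 : 0 ≤ s) (hs1 : s ≤ 1) (hb : 0 < b) (hbβ : b ≤ β)
    (hax : (1 - s) * b + s * β ≤ x) {t : Finset ι} {u vv m : ι → ℝ} (hadm : AdmissibleG s b β x t u vv m) {i j : ι}
    (hij : i ≠ j) (hi : i ∈ t) (hj : j ∈ t) {τ : ℝ} (hτ : 0 < τ) (hmi : b ≤ m i * τ) (hvi : β ≤ vv i * τ)
    (hmj : b * τ ≤ m j) (hvj : β * τ ≤ vv j) :
    AdmissibleG s b β x t (Function.update (Function.update u i (u i * τ)) j (u j / τ))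
      (Function.update (Function.update vv i (vv i * τ)) j (vv j / τ))
      (Function.update (Function.update m i (m i * τ)) j (m j / τ)) := by
  have h1 : AdmissibleOn s b β 1 t u vv m := hadm.toOn hs0 hs1 hb hbβ hax
  have h2 : AdmissibleOn s b β 1 t (Function.update (Function.update u i (u i * τ)) j (u j / τ))
      (Function.update (Function.update vv i (vv i * τ)) j (vv j / τ))
      (Function.update (Function.update m i (m i * τ)) j (m j / τ)) :=
    admissibleOn_scale hb hbβ h1 hij hi hj hτ hmi hvi hmj hvj
  obtain ⟨hub', hu1', hvβ', hv1', hmb', hmu', hmv', hpu', hpv', -⟩ := h2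
  obtain ⟨-, -, -, -, -, -, -, -, -, hpg⟩ := hadm
  refine ⟨hub', hu1', hvβ', hv1', hmb', hmu', hmv', hpu', by rw [mul_one] at hpv'; exact hpv', ?_⟩
  -- the block product is unchanged
  have e : ∀ l ∈ t, (1 - s) * Function.update (Function.update m i (m i * τ)) j (m j / τ) l +
      s * Function.update (Function.update vv i (vv i * τ)) j (vv j / τ) l =
      Function.update (Function.update (fun l => (1 - s) * m l + s * vv l) i
        ((fun l => (1 - s) * m l + s * vv l) i * τ)) j ((fun l => (1 - s) * m l + s * vv l) j / τ) l := by
    intro l _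
    by_cases hli : l = i
    · subst hli
      rw [Function.update_of_ne hij, Function.update_self, Function.update_of_ne hij, Function.update_self,
        Function.update_of_ne hij, Function.update_self]; ring
    by_cases hlj : l = j
    · subst hlj
      rw [Function.update_self, Function.update_self, Function.update_self]; ring
    rw [uExchange_apply_other τ hli hlj, uExchange_apply_other τ hli hlj, uExchange_apply_other τ hli hlj]
  rw [prod_congr rfl e, prod_update_scale hij hi hj _ hτ.ne']
  exact hpg

/-- **The scaling move with an extra factor `E ≥_coef 0`: a coefficient at `τ = 1` is at most the larger of the coefficients at
the endpoints.** [this work] -/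
theorem coeff_scale_mul_le_max [DecidableEq ι] {s : ℝ} (hs0 : 0 ≤ s) (hs1 : s ≤ 1) {t : Finset ι} {u vv m : ι → ℝ}
    (hu : ∀ l ∈ t, 0 ≤ u l) (hm : ∀ l ∈ t, 0 ≤ m l) (hv : ∀ l ∈ t, 0 ≤ vv l) {i j : ι} (hij : i ≠ j) (hi : i ∈ t)
    (hj : j ∈ t) {tlo thi : ℝ} (hlo : 0 < tlo) (hlo1 : tlo ≤ 1) (hhi : 1 ≤ thi) {E : ℝ[X]} (hE : CoefNonneg E) (k : ℕ) :
    (prodPoly t (fun l => s + (1 - s) * u l) (fun l => (1 - s) * m l + s * vv l) * E).coeff k ≤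
      max ((prodPoly t (fun l => s + (1 - s) * Function.update (Function.update u i (u i * tlo)) j (u j / tlo) l)
            (fun l => (1 - s) * Function.update (Function.update m i (m i * tlo)) j (m j / tlo) l +
              s * Function.update (Function.update vv i (vv i * tlo)) j (vv j / tlo) l) * E).coeff k)
        ((prodPoly t (fun l => s + (1 - s) * Function.update (Function.update u i (u i * thi)) j (u j / thi) l)
            (fun l => (1 - s) * Function.update (Function.update m i (m i * thi)) j (m j / thi) l +
              s * Function.update (Function.update vv i (vv i * thi)) j (vv j / thi) l) * E).coeff k) := by
  have hs' : 0 ≤ 1 - s := sub_nonneg.2 hs1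
  have hjt : j ∈ t.erase i := mem_erase.2 ⟨hij.symm, hj⟩
  have hit : i ∉ t.erase i := notMem_erase i t
  have hjt' : j ∉ (t.erase i).erase j := notMem_erase j _
  set c : ι → ℝ := fun l => (1 - s) * m l + s * vv l with hcd
  have hc : ∀ l ∈ t, 0 ≤ c l := fun l hl => add_nonneg (mul_nonneg hs' (hm l hl)) (mul_nonneg hs0 (hv l hl))
  set R₀ := prodPoly ((t.erase i).erase j) (fun l => s + (1 - s) * u l) c with hR₀d
  set R := R₀ * E with hRd
  have hR : CoefNonneg R := (coefNonneg_prodPoly _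
    (fun l hl => add_nonneg hs0 (mul_nonneg hs' (hu l (mem_of_mem_erase (mem_of_mem_erase hl)))))
    (fun l hl => hc l (mem_of_mem_erase (mem_of_mem_erase hl)))).mul hE
  have e4 : ∀ p q r e : ℝ[X], p * (q * r) * e = p * q * (r * e) := fun _ _ _ _ => by ring
  have ho' : ∀ {f : ι → ℝ} (τ : ℝ) (l : ι), l ≠ i → l ≠ j →
      Function.update (Function.update f i (f i * τ)) j (f j / τ) l = f l :=
    fun {f} τ l hli hlj => uExchange_apply_other τ hli hlj
  have fac : ∀ τ : ℝ, τ ≠ 0 →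
      prodPoly t (fun l => s + (1 - s) * Function.update (Function.update u i (u i * τ)) j (u j / τ) l)
          (fun l => (1 - s) * Function.update (Function.update m i (m i * τ)) j (m j / τ) l +
            s * Function.update (Function.update vv i (vv i * τ)) j (vv j / τ) l) * E =
        (C ((s ^ 2 + (1 - s) ^ 2 * (u i * u j)) + s * (1 - s) * u i * τ + s * (1 - s) * u j / τ) * X ^ 2 +
          C ((1 - s) * (u i * c j + u j * c i) + s * c i * τ + s * c j / τ) * X +
          C (c i * c j + 0 * τ + 0 / τ)) * R := by
    intro τ hτ
    have hrest : prodPoly ((t.erase i).erase j)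
        (fun l => s + (1 - s) * Function.update (Function.update u i (u i * τ)) j (u j / τ) l)
        (fun l => (1 - s) * Function.update (Function.update m i (m i * τ)) j (m j / τ) l +
          s * Function.update (Function.update vv i (vv i * τ)) j (vv j / τ) l) = R₀ :=
      prodPoly_congr
        (fun l hl => by rw [ho' τ l (mem_erase.1 (mem_of_mem_erase hl)).1 (mem_erase.1 hl).1])
        (fun l hl => by
          rw [ho' τ l (mem_erase.1 (mem_of_mem_erase hl)).1 (mem_erase.1 hl).1,
            ho' τ l (mem_erase.1 (mem_of_mem_erase hl)).1 (mem_erase.1 hl).1])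
    rw [← insert_erase hi, prodPoly_insert hit, ← insert_erase hjt, prodPoly_insert hjt', hrest, e4,
      lin_mul_lin]
    simp only [Function.update_self, Function.update_of_ne hij]
    have e2 : (s + (1 - s) * (u i * τ)) * (s + (1 - s) * (u j / τ)) =
        (s ^ 2 + (1 - s) ^ 2 * (u i * u j)) + s * (1 - s) * u i * τ + s * (1 - s) * u j / τ := by
      field_simp; ring
    have e1 : (s + (1 - s) * (u i * τ)) * ((1 - s) * (m j / τ) + s * (vv j / τ)) +
        ((1 - s) * (m i * τ) + s * (vv i * τ)) * (s + (1 - s) * (u j / τ)) =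
        (1 - s) * (u i * c j + u j * c i) + s * c i * τ + s * c j / τ := by
      rw [hcd]; field_simp; ring
    have e0 : ((1 - s) * (m i * τ) + s * (vv i * τ)) * ((1 - s) * (m j / τ) + s * (vv j / τ)) =
        c i * c j + 0 * τ + 0 / τ := by
      rw [hcd]; field_simp; ring
    rw [e2, e1, e0]
  have fac1 : prodPoly t (fun l => s + (1 - s) * u l) c * E =
      (C ((s ^ 2 + (1 - s) ^ 2 * (u i * u j)) + s * (1 - s) * u i + s * (1 - s) * u j) * X ^ 2 +
        C ((1 - s) * (u i * c j + u j * c i) + s * c i + s * c j) * X + C (c i * c j + 0 + 0)) * R := by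
    have h := fac 1 one_ne_zero
    simp only [mul_one, div_one, Function.update_eq_self] at h
    exact h
  rw [fac1, fac tlo hlo.ne', fac thi (by linarith)]
  exact coeff_quad_mul_le_max hR k (mul_nonneg (mul_nonneg hs0 hs') (hu j hj)) (mul_nonneg hs0 (hc j hj))
    le_rfl hlo hlo1 hhi

end LinkedCurrency

end SafeCalc

end Summit.CriticalPhenomena.PercolationContinuityZ3.Theorems.SunflowerPartition
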